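import Summits.RiemannHypothesis.RiemannHypothesis.Theorems.HandoffCapacity
import Summits.RiemannHypothesis.RiemannHypothesis.Theorems.HandoffSemilocalParitySplit
import HarnessLib

/-!
# HANDOFF — the capacity of a place, part 3: ONE SECTOR CARRIES THE CAPACITY (cell rh-explicit, TRACK «HANDOFF», seat theory-2 gen5, file XII-j)

HONEST FRAMING. Nothing here bears on the truth of RH. Part 1 (`HandoffCapacity.lean`, XII-h) typed the capacity
`ρ(S, p; b; P) = bsCapacity S p P b = sup placeGain p g / Re Q_{S ∪ {p}}(g)` over the unit sphere of `C(b)^P` and proved that the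
semi-local wall is its unit level set. This file is the capacity analogue of the parity split of the ground energy
(`HandoffSemilocalParitySplit.semilocalGroundEnergy_eq_min_even_odd`, `HandoffWallSector`): the gain of a place is parity-diagonal
(`placeGain_add_of_even_odd`: `placeGain p (e + o) = placeGain p e + placeGain p o`, cross terms vanish as for every `Q_S`) and
homogeneous (`placeGain_const_mul`), so by the mediant inequality

  **`bsCapacity S p ⊤ b = max (bsCapacity S p even b) (bsCapacity S p odd b)`**  (`bsCapacity_top_eq_max_even_odd`, under `0 < λ_min(S ∪ {p}; b)`, `0 < b`)

— the all-test capacity of a place is carried by ONE parity sector. Which one is DATA, not a theorem: on the handoff windows the cell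
measures the ODD sector at the crossing and the EVEN capacity at 0.22 … 0.01 of it (theory-2 CAPCURVE §6, DERIVED-CHECK), i.e.
«odd carries the wall, even carries the margin» (HANDOFF-STATEMENT §H.2) — here given its exact kernel frame.

References: Connes–Consani 2023 §2.1.3 (the even/odd block structure of the semi-local form) [`ConnesConsani2023`]; M. Suzuki (2026) §4.5 eq. (4.10)
(the parity split of a Rayleigh bottom) [`Suzuki2026`]; Bombieri 2000 §4 [`Bombieri2000Weil`]. The capacity object is this cell's, not in print.
-/

set_option linter.dupNamespace false  -- the mandated namespace repeats `RiemannHypothesis`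

noncomputable section
open Set Complex MeasureTheory Literature.NumberTheory.LFunctions
open Summit.RiemannHypothesis.RiemannHypothesis.Theorems.Handoff
open Summit.RiemannHypothesis.RiemannHypothesis.Theorems.HandoffAnalytic
open Summit.RiemannHypothesis.RiemannHypothesis.Theorems.HandoffSemilocalEnergy
open Summit.RiemannHypothesis.RiemannHypothesis.Theorems.HandoffSemilocalParitySplit
open Summit.RiemannHypothesis.RiemannHypothesis.Theorems.HandoffCapacity
open Summit.RiemannHypothesis.RiemannHypothesis.Theorems.MotivicDoor.SemilocalThreshold
open Summit.RiemannHypothesis.RiemannHypothesis.Theorems.MotivicDoor.Semilocal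
open scoped Real ComplexConjugate ArithmeticFunction.vonMangoldt

namespace Summit.RiemannHypothesis.RiemannHypothesis.Theorems.HandoffCapacitySectors

variable {g e o : ℝ → ℂ} {S : Finset ℕ} {P : (ℝ → ℂ) → Prop} {b : ℝ} {p : ℕ}

/-! ## §1 The gain is parity-diagonal and homogeneous -/

/-- `placeGain p g = Re Q_{{p}}(g) − Re Q_∅(g)` (the increment of the empty form by the place `p`). [folklore] -/
theorem placeGain_eq_sub (hp : p.Prime) (hg : IsWeilTest g) :
    placeGain p g = (weilSemilocalQuadratic {p} g).re - (weilSemilocalQuadratic ∅ g).re := by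
  have h := re_weilSemilocalQuadratic_eq_sub_placeGain (S := ∅) hp (Finset.notMem_empty p) hg
  rw [Finset.insert_empty] at h
  linarith

/-- **The gain is parity-diagonal**: `placeGain p (e + o) = placeGain p e + placeGain p o` for `e` even, `o` odd (both semi-local forms
`Q_{{p}}`, `Q_∅` split, `weilSemilocalQuadratic_add_of_even_odd`). [cite: ConnesConsani2023, §2.1.3 (the form is block-diagonal in parity), primes restricted] -/
theorem placeGain_add_of_even_odd (hp : p.Prime) (he : IsWeilTest e) (ho : IsWeilTest o) (hev : ∀ t, e (-t) = e t)
    (hodd : ∀ t, o (-t) = -o t) : placeGain p (e + o) = placeGain p e + placeGain p o := by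
  rw [placeGain_eq_sub hp (he.add ho), placeGain_eq_sub hp he, placeGain_eq_sub hp ho,
    weilSemilocalQuadratic_add_of_even_odd {p} he ho hev hodd, weilSemilocalQuadratic_add_of_even_odd ∅ he ho hev hodd,
    Complex.add_re, Complex.add_re]
  ring

/-- The semi-local PRIME term is linear: `Pr_S(m·k) = m·Pr_S(k)`. [folklore] -/
theorem weilSemilocalPrimeTerm_const_mul (S : Finset ℕ) (m : ℂ) (k : ℝ → ℂ) :
    weilSemilocalPrimeTerm S (fun t ↦ m * k t) = m * weilSemilocalPrimeTerm S k := by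
  simp only [weilSemilocalPrimeTerm]
  rw [← tsum_mul_left]
  congr 1 with n
  ring

/-- **Homogeneity**: `placeGain p (c·g) = |c|²·placeGain p g`. [folklore] -/
theorem placeGain_const_mul (p : ℕ) (c : ℂ) (g : ℝ → ℂ) :
    placeGain p (fun t ↦ c * g t) = Complex.normSq c * placeGain p g := by
  have hconv : weilConv (fun t ↦ c * g t) (weilReflect fun t ↦ c * g t) =
      fun t ↦ (Complex.normSq c : ℂ) * weilConv g (weilReflect g) t := by
    funext t
    rw [weilConv_apply, weilConv_apply, ← integral_const_mul]
    congr 1 with u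
    simp only [weilReflect, map_mul, Complex.normSq_eq_conj_mul_self]
    ring
  rw [placeGain, placeGain, hconv, weilSemilocalPrimeTerm_const_mul, Complex.re_ofReal_mul]
  ring

/-! ## §2 The gain is bounded by `ρ · Re Q_{S ∪ {p}}` on the whole cone, not only on the sphere -/

/-- For every `g ∈ C(b)` whose positive multiples satisfy `P`: `placeGain p g ≤ ρ(S, p; b; P)·Re Q_{S ∪ {p}}(g)` (normalise; both sides are
homogeneous of degree two). [folklore] -/
theorem placeGain_le_bsCapacity_mul_of_cone (hpos : 0 < semilocalGroundEnergy (insert p S) P b) (hg : IsWeilTest g)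
    (hs : tsupport g ⊆ Icc (-b) b) (hP : ∀ c : ℝ, 0 < c → P fun t ↦ (c : ℂ) * g t) :
    placeGain p g ≤ bsCapacity S p P b * (weilSemilocalQuadratic (insert p S) g).re := by
  have hN2nn : 0 ≤ ∫ t : ℝ, ‖g t‖ ^ 2 := integral_nonneg fun _ ↦ by positivity
  rcases hN2nn.eq_or_lt with hz | hposN
  · have hg0 : g = 0 := hg.eq_zero_of_integral_norm_sq_eq_zero hz.symm
    subst hg0
    have h0 : placeGain p (0 : ℝ → ℂ) = 0 := by
      have h1 := placeGain_const_mul p 0 (0 : ℝ → ℂ)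
      have h2 : (fun t : ℝ ↦ (0 : ℂ) * (0 : ℝ → ℂ) t) = 0 := by funext t; simp
      rw [h2] at h1
      simpa using h1
    rw [h0, weilSemilocalQuadratic_zero, Complex.zero_re, mul_zero]
  · set N2 : ℝ := ∫ t : ℝ, ‖g t‖ ^ 2 with hN2
    set c : ℝ := (Real.sqrt N2)⁻¹ with hc
    have hcpos : 0 < c := inv_pos.2 (Real.sqrt_pos.2 hposN)
    have hunit : ∫ t : ℝ, ‖(c : ℂ) * g t‖ ^ 2 = 1 := by
      simp only [norm_mul, mul_pow, Complex.norm_real, Real.norm_of_nonneg hcpos.le]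
      rw [integral_const_mul, hc, inv_pow, Real.sq_sqrt hN2nn, inv_mul_cancel₀ hposN.ne']
    have h := placeGain_le_bsCapacity_mul hpos (hg.const_mul c) (tsupport_mul_subset_right.trans hs) (hP c hcpos) hunit
    rw [placeGain_const_mul, weilSemilocalQuadratic_const_mul, Complex.normSq_ofReal, Complex.re_ofReal_mul] at h
    have hcc : 0 < c * c := mul_pos hcpos hcpos
    have h' : c * c * placeGain p g ≤ c * c * (bsCapacity S p P b * (weilSemilocalQuadratic (insert p S) g).re) := by
      linarith
    exact le_of_mul_le_mul_left h' hcc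

/-! ## §3 The all-test capacity is the larger of the two sector capacities -/

/-- A constrained sphere is a sub-sphere: `ρ(S, p; b; P) ≤ ρ(S, p; b; ⊤)` whenever the `P`-ratio set is nonempty and the all-test form is
positive (`0 < λ_min(S ∪ {p}; b)`). [folklore] -/
theorem bsCapacity_le_top (hpos : 0 < semilocalGroundEnergy (insert p S) (fun _ ↦ True) b)
    (hne : (semilocalSphereValues S P b).Nonempty) :
    bsCapacity S p P b ≤ bsCapacity S p (fun _ ↦ True) b := by
  refine csSup_le_csSup (capacitySet_bddAbove hpos) (capacitySet_nonempty_iff.2 hne) ?_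
  rintro r ⟨g, hg, hs, -, hn, rfl⟩
  exact ⟨g, hg, hs, trivial, hn, rfl⟩

/-- **ONE SECTOR CARRIES THE CAPACITY**: for `0 < b` and `0 < λ_min(S ∪ {p}; b)` (all-test sector; `p` prime),
`ρ(S, p; b; ⊤) = max (ρ(S, p; b; even)) (ρ(S, p; b; odd))`. (`≥`: sub-spheres. `≤`: for a unit `g = g_ev + g_od`,
`placeGain p g = placeGain p g_ev + placeGain p g_od ≤ ρ_ev Re Q'(g_ev) + ρ_od Re Q'(g_od) ≤ max(ρ_ev, ρ_od)·Re Q'(g)`, the sector energies being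
non-negative.) [cite: Suzuki2026, §4.5 eq. (4.10) (parity split of a Rayleigh extremum), transposed to the capacity quotient; this track] -/
theorem bsCapacity_top_eq_max_even_odd (hp : p.Prime) (hb : 0 < b)
    (hpos : 0 < semilocalGroundEnergy (insert p S) (fun _ ↦ True) b) :
    bsCapacity S p (fun _ ↦ True) b = max (bsCapacity S p (fun g : ℝ → ℂ ↦ ∀ t, g (-t) = g t) b) (bsCapacity S p (fun g : ℝ → ℂ ↦ ∀ t, g (-t) = -g t) b) := by
  -- positivity of the all-test form gives positivity of the two sector forms (sub-spheres)
  have hposE : 0 < semilocalGroundEnergy (insert p S) (fun g : ℝ → ℂ ↦ ∀ t, g (-t) = g t) b :=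
    hpos.trans_le (semilocalGroundEnergy_le_even (insert p S) b)
  have hposO : 0 < semilocalGroundEnergy (insert p S) (fun g : ℝ → ℂ ↦ ∀ t, g (-t) = -g t) b :=
    hpos.trans_le (semilocalGroundEnergy_le_odd (insert p S) b)
  refine le_antisymm ?_ (max_le (bsCapacity_le_top hpos (semilocalSphereValues_even_nonempty S hb))
    (bsCapacity_le_top hpos (semilocalSphereValues_odd_nonempty S hb)))
  set RE : ℝ := bsCapacity S p (fun g : ℝ → ℂ ↦ ∀ t, g (-t) = g t) b
  set RO : ℝ := bsCapacity S p (fun g : ℝ → ℂ ↦ ∀ t, g (-t) = -g t) b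
  refine csSup_le (capacitySet_nonempty_iff.2 (semilocalSphereValues_top_nonempty S hb)) ?_
  rintro r ⟨g, hg, hs, -, hn, rfl⟩
  -- the parts
  have het : IsWeilTest fun t ↦ (g t + g (-t)) / 2 := hg.evenPart
  have hot : IsWeilTest fun t ↦ (g t - g (-t)) / 2 := hg.oddPart
  have hes : tsupport (fun t ↦ (g t + g (-t)) / 2) ⊆ Icc (-b) b :=
    tsupport_subset_Icc_of_symm hs fun s h1 h2 ↦ by simp only [h1, h2, add_zero, zero_div]
  have hos : tsupport (fun t ↦ (g t - g (-t)) / 2) ⊆ Icc (-b) b :=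
    tsupport_subset_Icc_of_symm hs fun s h1 h2 ↦ by simp only [h1, h2, sub_zero, zero_div]
  have hev : ∀ t, (fun t ↦ (g t + g (-t)) / 2) (-t) = (fun t ↦ (g t + g (-t)) / 2) t := fun t ↦ by
    simp only [neg_neg]; ring
  have hodd : ∀ t, (fun t ↦ (g t - g (-t)) / 2) (-t) = -(fun t ↦ (g t - g (-t)) / 2) t := fun t ↦ by
    simp only [neg_neg]; ring
  have hsum : g = (fun t ↦ (g t + g (-t)) / 2) + fun t ↦ (g t - g (-t)) / 2 := by
    funext t; simp only [Pi.add_apply]; ring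
  -- gain and energy split
  have hGsplit : placeGain p g = placeGain p (fun t ↦ (g t + g (-t)) / 2) + placeGain p (fun t ↦ (g t - g (-t)) / 2) := by
    conv_lhs => rw [hsum]
    exact placeGain_add_of_even_odd hp het hot hev hodd
  have hQsplit : (weilSemilocalQuadratic (insert p S) g).re =
      (weilSemilocalQuadratic (insert p S) fun t ↦ (g t + g (-t)) / 2).re +
        (weilSemilocalQuadratic (insert p S) fun t ↦ (g t - g (-t)) / 2).re := by
    rw [weilSemilocalQuadratic_eq_evenPart_add_oddPart (insert p S) hg, Complex.add_re]
  -- sector bounds on the cone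
  have hGe := placeGain_le_bsCapacity_mul_of_cone (S := S) (P := (fun g : ℝ → ℂ ↦ ∀ t, g (-t) = g t)) hposE het hes fun c _ t ↦ by
    show (c : ℂ) * ((g (-t) + g (- -t)) / 2) = (c : ℂ) * ((g t + g (-t)) / 2)
    rw [neg_neg, add_comm]
  have hGo := placeGain_le_bsCapacity_mul_of_cone (S := S) (P := (fun g : ℝ → ℂ ↦ ∀ t, g (-t) = -g t)) hposO hot hos fun c _ t ↦ by
    show (c : ℂ) * ((g (-t) - g (- -t)) / 2) = -((c : ℂ) * ((g t - g (-t)) / 2))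
    rw [neg_neg]; ring
  -- sector energies are non-negative
  have hQe : 0 ≤ (weilSemilocalQuadratic (insert p S) fun t ↦ (g t + g (-t)) / 2).re :=
    (mul_nonneg hposE.le (integral_nonneg fun _ ↦ by positivity)).trans
      (semilocalGroundEnergy_mul_le_re het hes fun c _ t ↦ by
        show (c : ℂ) * ((g (-t) + g (- -t)) / 2) = (c : ℂ) * ((g t + g (-t)) / 2)
        rw [neg_neg, add_comm])
  have hQo : 0 ≤ (weilSemilocalQuadratic (insert p S) fun t ↦ (g t - g (-t)) / 2).re :=
    (mul_nonneg hposO.le (integral_nonneg fun _ ↦ by positivity)).trans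
      (semilocalGroundEnergy_mul_le_re hot hos fun c _ t ↦ by
        show (c : ℂ) * ((g (-t) - g (- -t)) / 2) = -((c : ℂ) * ((g t - g (-t)) / 2))
        rw [neg_neg]; ring)
  have hQpos : 0 < (weilSemilocalQuadratic (insert p S) g).re :=
    hpos.trans_le (semilocalGroundEnergy_le_re hg hs trivial hn)
  -- mediant
  rw [div_le_iff₀ hQpos, hGsplit, hQsplit, mul_add]
  have h1 : RE * (weilSemilocalQuadratic (insert p S) fun t ↦ (g t + g (-t)) / 2).re ≤
      max RE RO * (weilSemilocalQuadratic (insert p S) fun t ↦ (g t + g (-t)) / 2).re :=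
    mul_le_mul_of_nonneg_right (le_max_left _ _) hQe
  have h2 : RO * (weilSemilocalQuadratic (insert p S) fun t ↦ (g t - g (-t)) / 2).re ≤
      max RE RO * (weilSemilocalQuadratic (insert p S) fun t ↦ (g t - g (-t)) / 2).re :=
    mul_le_mul_of_nonneg_right (le_max_right _ _) hQo
  linarith

/-- Hence the **wall is crossed in one sector first**: under the hypotheses, `ρ(S, p; b; ⊤) ≤ 1 ↔ ρ_even ≤ 1 ∧ ρ_odd ≤ 1` — the capacity form of
`HandoffSemilocalParitySplit.weilSemilocalPositivityOn_iff_sectors`. [folklore] -/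
theorem bsCapacity_top_le_one_iff_sectors (hp : p.Prime) (hb : 0 < b)
    (hpos : 0 < semilocalGroundEnergy (insert p S) (fun _ ↦ True) b) :
    bsCapacity S p (fun _ ↦ True) b ≤ 1 ↔ bsCapacity S p (fun g : ℝ → ℂ ↦ ∀ t, g (-t) = g t) b ≤ 1 ∧ bsCapacity S p (fun g : ℝ → ℂ ↦ ∀ t, g (-t) = -g t) b ≤ 1 := by
  rw [bsCapacity_top_eq_max_even_odd hp hb hpos, max_le_iff]

end Summit.RiemannHypothesis.RiemannHypothesis.Theorems.HandoffCapacitySectors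
end
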